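import Literature.AlgebraicGeometry.HodgeTheory.DworkSexticReflectionQuotient
import Literature.AlgebraicGeometry.HodgeTheory.HodgeTypePullback
import Literature.AlgebraicGeometry.HodgeTheory.HodgeTypeConjugation
import Literature.AlgebraicGeometry.HodgeTheory.ComplexConjugationHolds
import HarnessLib

/-!
# Averaging over the six reflections `s_(i,j,ζ)`, `ζ ∈ μ₆`: eigenclasses of the Dwork sextic are
# sums of reflection-invariant classes

Family `hodge`, layer `Literature/AlgebraicGeometry/HodgeTheory`; a sequel to
`DworkSexticReflectionQuotient` (the reflections `s_(i,j,ζ) : x_i ↦ ζ x_j, x_j ↦ ζ⁻¹ x_i` of the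
Dwork sextic fourfold `X_ψ : Σ x_l⁶ − 6ψ ∏ x_l = 0`, Bini–Garbagnati §3.4, realised on `X_ψ(ℂ)`) and
`DworkSexticEigenspaces` (the eigenclasses `IsEig ψ e c` of `H⁴(X_ψ(ℂ); ℂ)` under the diagonal group
`A = {a ∈ μ₆⁶ : ∏ aₗ = 1}`, `g_a^* c = (∏ aₗ^{eₗ}) c`, Katz 2009 §2–§3). Written by the `hodge-nonav`
literature seat for crux K2 `FlatClassesSpannedByReflectionInvariants` (stmt-HodgeConjecture-20241) of
route `HodgeConjecture/DworkReflectionQuotients`: the crux asks that every rational class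
`w = u + v`, `u ∈ V(e)`, `v ∈ V(ē)` (`e` one of Katz's four flat exponent types up to `𝔖₆`), lie in
the `ℂ`-span of rational `(2,2)`-classes each invariant under SOME reflection `s_(i,i',ζ)`.

## The argument (elementary; everything PROVED, no named fact introduced)

Fix a pair `i ≠ j` with `eᵢ ≢ eⱼ (mod 6)` (every non-constant exponent vector has one) and a
primitive sixth root of unity `ζ₀`; let `g_k` realise `s_(i,j,ζ₀ᵏ)` on `X_ψ(ℂ)`, `k = 0,…,5`
(`DworkSextic.exists_continuousMap_isRefl`). On homogeneous coordinates
`s_(i,j,ζ) = diag(reflCoeff i j ζ) ∘ s_(i,j,1)` with `reflCoeff i j ζ = (ζ at i, ζ⁻¹ at j, 1 else) ∈ A`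
(`reflCoeff_pow_six`, `prod_reflCoeff`), so by uniqueness of realising maps (`refl_unique`)
`g_ζ = g_a ∘ g_1` and, for an eigenclass `u` of exponent `e`,
`g_ζ^* u = χ_e(a) · g_1^* u = ζ^{eᵢ} ζ^{-eⱼ} · g_1^* u` (`map_eq_smul_map_of_isEig`). Summing over
`ζ = ζ₀ᵏ`: `Σ_k g_k^* u = (Σ_k ωᵏ) g_0^* u = 0` with `ω = ζ₀^{eᵢ + 5eⱼ} ≠ 1` (`sum_map_eq_zero_of_isEig`),
hence for `w = u + v` with both exponent vectors separating `i` from `j`: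

  `6 · w = Σ_{k<6} (w + g_k^* w)`                      (`six_smul_eq_sum_add_map`)

and each summand `c_k = w + g_k^* w` is `g_k`-invariant (`g_k ∘ g_k = id`, the reflection being an
involution of the scheme `X_ψ`, `reflIso_hom_comp_reflIso_hom`), rational if `w` is (pull-backs of
rational classes are rational), and of Hodge type `(2,2)` if `w` is (pull-back along the algebraic
automorphism `reflIso`, Voisin I §7.3.2 = the tree's `IsOfHodgeType.map_of_le`, and
`IsOfHodgeType.add`). So `w ∈ span_ℂ {c_k}` (`mem_span_reflInvariant_of_isEig_add`): the crux's
conclusion for any rational `(2,2)`-class `w = u + v`; the `(2,2)`-ness of `u + v` itself is Katz 2009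
Lemma 3.1(2) (the tree's named fact `Katz2009_dworkSexticEigenspaces`, corollary
`isOfHodgeType_two_two`), whence the `…_of_katz` form. No representation theory of `A ⋊ 𝔖₆`, no
determinant character and no quotient variety is used.

## References

* N. M. Katz, *Another look at the Dwork family*, Progr. Math. 270 (2009) 89–126, §2 pp. 5–7 (the
  action of `Γ_W` and the characters `χ_e`), Lemma 3.1. [Katz2009]
* G. Bini, A. Garbagnati, *Quotients of the Dwork pencil*, J. Geom. Phys. 75 (2014) 173–198
  (arXiv:1207.7175), §3.4 (the reflections `s_(i,j,ζ)`, all conjugate under `A`). [BiniGarbagnati2012]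
* C. Voisin, *Hodge Theory and Complex Algebraic Geometry I* (2002), §7.3.2 (pull-backs are morphisms
  of Hodge structures). [VoisinHodgeI2002]
-/

noncomputable section

open CategoryTheory
open scoped BigOperators
open Literature.AlgebraicTopology.SingularHomology

namespace Literature.AlgebraicGeometry.HodgeTheory.DworkSextic

/-! ### §1 Realising maps: reflections and diagonal symmetries on `X_ψ(ℂ)` -/

section Realise

variable (ψ : ℂ)

/-- `g` realises the reflection `s_(i,j,ζ)` on homogeneous coordinates:
`rep (pt (g x)) = t • (k ↦ ζ x_j | ζ⁻¹ x_i | x_k)` — literally the clause `IsRefl i j ζ g` of the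
route's cruxes. [cite: BiniGarbagnati2012, §3.4] -/
def IsReflMap (i j : Fin 6) (ζ : ℂ)
    (g : C(Motives.ComplexPoints (fibre ψ), Motives.ComplexPoints (fibre ψ))) : Prop :=
  ∀ x, ∃ t : ℂ, (pt ψ (g x)).rep = t • (fun k => if k = i then ζ * (pt ψ x).rep j
    else if k = j then ζ⁻¹ * (pt ψ x).rep i else (pt ψ x).rep k)

/-- `g` realises the diagonal symmetry `[x] ↦ [a • x]` (the clause of `HasSymmetry` / `IsEig`).
[cite: Katz2009, §2 p. 5] -/
def IsDiagMap (a : Fin 6 → ℂ)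
    (g : C(Motives.ComplexPoints (fibre ψ), Motives.ComplexPoints (fibre ψ))) : Prop :=
  ∀ x, ∃ t : ℂ, (pt ψ (g x)).rep = t • (a * (pt ψ x).rep)

variable {ψ} {i j : Fin 6} {ζ : ℂ}

/-- **`s_(i,j,ζ) = diag(reflCoeff i j ζ) ∘ s_(i,j,1)` on realising maps**: if `g₁` realises
`s_(i,j,1)` and `g_a` realises the diagonal symmetry `a = reflCoeff i j ζ = (ζ at i, ζ⁻¹ at j, 1)`,
then `g_a ∘ g₁` realises `s_(i,j,ζ)`. [cite: BiniGarbagnati2012, §3.4 (conjugacy of the s_(i,j,ζ) under A)] -/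
theorem isReflMap_comp_of_isDiagMap (hij : i ≠ j)
    {g₁ ga : C(Motives.ComplexPoints (fibre ψ), Motives.ComplexPoints (fibre ψ))}
    (hg₁ : IsReflMap ψ i j 1 g₁) (hga : IsDiagMap ψ (reflCoeff i j ζ) ga) :
    IsReflMap ψ i j ζ (ga.comp g₁) := by
  intro x
  obtain ⟨t₁, ht₁⟩ := hg₁ x
  obtain ⟨t₂, ht₂⟩ := hga (g₁ x)
  refine ⟨t₂ * t₁, ?_⟩
  rw [ContinuousMap.comp_apply, ht₂, ht₁]
  funext k
  simp only [Pi.smul_apply, Pi.mul_apply, smul_eq_mul, one_mul, inv_one]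
  rcases eq_or_ne k i with rfl | hki
  · rw [if_pos rfl, if_pos rfl, reflCoeff_left hij]; ring
  · rcases eq_or_ne k j with rfl | hkj
    · rw [if_neg hki, if_pos rfl, if_neg hki, if_pos rfl, reflCoeff_right hij]; ring
    · rw [if_neg hki, if_neg hkj, if_neg hki, if_neg hkj, reflCoeff_of_ne hki hkj]; ring

/-- **Any realising map of `s_(i,j,ζ)` is the analytification of the scheme automorphism `reflIso`**
(uniqueness of realising maps, `refl_unique`). [cite: BiniGarbagnati2012, §3.4] [cite: SerreGAGA1956, §2 n°5] -/
theorem eq_mapContinuous_reflIso_of_isReflMap (hij : i ≠ j) (hζ : ζ ^ 6 = 1)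
    {g : C(Motives.ComplexPoints (fibre ψ), Motives.ComplexPoints (fibre ψ))} (hg : IsReflMap ψ i j ζ g) :
    g = Motives.AlgPoints.mapContinuous (L := ℂ) (reflIso ψ hij hζ).hom :=
  refl_unique ψ hg fun x => by
    obtain ⟨t, -, ht⟩ := exists_rep_pt_reflIso ψ hij hζ x
    exact ⟨t, by rw [Motives.AlgPoints.mapContinuous_apply]; exact ht⟩

/-- **A realising map of a reflection is an involution**: `g ∘ g = id` (`s ≫ s = 𝟙` on the scheme,
`reflIso_hom_comp_reflIso_hom`). [cite: BiniGarbagnati2012, §3.4] -/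
theorem comp_self_eq_id_of_isReflMap (hij : i ≠ j) (hζ : ζ ^ 6 = 1)
    {g : C(Motives.ComplexPoints (fibre ψ), Motives.ComplexPoints (fibre ψ))} (hg : IsReflMap ψ i j ζ g) :
    g.comp g = ContinuousMap.id _ := by
  rw [eq_mapContinuous_reflIso_of_isReflMap hij hζ hg]
  ext x
  rw [ContinuousMap.comp_apply, ContinuousMap.id_apply, Motives.AlgPoints.mapContinuous_apply,
    Motives.AlgPoints.mapContinuous_apply, ← Motives.AlgPoints.map_comp_apply,
    reflIso_hom_comp_reflIso_hom, Motives.AlgPoints.map_id_apply]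

/-- `g^* (g^* c) = c` for a realising map of a reflection. [cite: BiniGarbagnati2012, §3.4] -/
theorem map_map_of_isReflMap (hij : i ≠ j) (hζ : ζ ^ 6 = 1)
    {g : C(Motives.ComplexPoints (fibre ψ), Motives.ComplexPoints (fibre ψ))} (hg : IsReflMap ψ i j ζ g)
    {n : ℕ} (c : complexBetti (fibre ψ) n) :
    singularCohomology.map ℂ ℂ g n (singularCohomology.map ℂ ℂ g n c) = c := by
  rw [← ModuleCat.comp_apply, ← singularCohomology.map_comp, comp_self_eq_id_of_isReflMap hij hζ hg,
    singularCohomology.map_id]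
  rfl

/-- **`c + g^* c` is `g`-invariant** for a realising map `g` of a reflection.
[cite: BiniGarbagnati2012, §3.4] -/
theorem map_add_map_of_isReflMap (hij : i ≠ j) (hζ : ζ ^ 6 = 1)
    {g : C(Motives.ComplexPoints (fibre ψ), Motives.ComplexPoints (fibre ψ))} (hg : IsReflMap ψ i j ζ g)
    {n : ℕ} (c : complexBetti (fibre ψ) n) :
    singularCohomology.map ℂ ℂ g n (c + singularCohomology.map ℂ ℂ g n c) =
      c + singularCohomology.map ℂ ℂ g n c := by
  rw [map_add, map_map_of_isReflMap hij hζ hg, add_comm]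

/-- **Pull-back along a realised reflection preserves rationality.** [cite: HatcherAT2002, §3.1] -/
theorem isRationalClass_add_map
    (g : C(Motives.ComplexPoints (fibre ψ), Motives.ComplexPoints (fibre ψ)))
    {n : ℕ} {c : complexBetti (fibre ψ) n} (hc : IsRationalClass c) :
    IsRationalClass (c + singularCohomology.map ℂ ℂ g n c) :=
  hc.add (hc.pullback g)

/-- **Pull-back along a realised reflection preserves the Hodge type** (`ψ⁶ ≠ 1`): the realising map
is the analytification of the automorphism `reflIso` of the smooth projective fourfold `X_ψ`, and
pull-backs along morphisms of smooth projective varieties preserve Hodge types (Voisin I §7.3.2).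
[cite: VoisinHodgeI2002, §7.3.2] -/
theorem isOfHodgeType_map_of_isReflMap (hψ : ψ ^ 6 ≠ 1) (hij : i ≠ j) (hζ : ζ ^ 6 = 1)
    {g : C(Motives.ComplexPoints (fibre ψ), Motives.ComplexPoints (fibre ψ))} (hg : IsReflMap ψ i j ζ g)
    {n p q : ℕ} {c : complexBetti (fibre ψ) n} (hc : IsOfHodgeType 4 (fibre ψ) n p q c) :
    IsOfHodgeType 4 (fibre ψ) n p q (singularCohomology.map ℂ ℂ g n c) := by
  obtain ⟨A, _⟩ := id hc
  rw [eq_mapContinuous_reflIso_of_isReflMap hij hζ hg]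
  exact hc.map_of_le (isSmoothProjective_fibre hψ) (isSmoothProjective_fibre hψ) A
    (reflIso ψ hij hζ).hom le_rfl

/-- Hence `c + g^* c` is of type `(p,q)` when `c` is (`ψ⁶ ≠ 1`). [cite: VoisinHodgeI2002, §7.1.1 and §7.3.2] -/
theorem isOfHodgeType_add_map_of_isReflMap (hψ : ψ ^ 6 ≠ 1) (hij : i ≠ j) (hζ : ζ ^ 6 = 1)
    {g : C(Motives.ComplexPoints (fibre ψ), Motives.ComplexPoints (fibre ψ))} (hg : IsReflMap ψ i j ζ g)
    {n p q : ℕ} {c : complexBetti (fibre ψ) n} (hc : IsOfHodgeType 4 (fibre ψ) n p q c) :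
    IsOfHodgeType 4 (fibre ψ) n p q (c + singularCohomology.map ℂ ℂ g n c) :=
  hc.add (isSmoothProjective_fibre hψ) (isOfHodgeType_map_of_isReflMap hψ hij hζ hg hc)

end Realise

/-! ### §2 The character twist `g_ζ^* u = ζ^{eᵢ} ζ^{-eⱼ} · g_1^* u` and the vanishing sum -/

section Twist

variable {ψ : ℂ} {i j : Fin 6}

/-- `χ_e(reflCoeff i j ζ) = ζ^{eᵢ} · (ζ⁻¹)^{eⱼ}`. [cite: Katz2009, §2 p. 5] -/
theorem prod_reflCoeff_pow (ζ : ℂ) (e : Fin 6 → ℕ) :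
    ∏ l, reflCoeff i j ζ l ^ e l = ζ ^ e i * ζ⁻¹ ^ e j := by
  have h : ∀ l, reflCoeff i j ζ l ^ e l =
      (if l = i then ζ ^ e l else 1) * (if l = j then ζ⁻¹ ^ e l else 1) := by
    intro l
    rw [reflCoeff, mul_pow]
    congr 1 <;> split_ifs <;> simp
  simp_rw [h]
  rw [Finset.prod_mul_distrib, Finset.prod_ite_eq' Finset.univ i, Finset.prod_ite_eq' Finset.univ j,
    if_pos (Finset.mem_univ i), if_pos (Finset.mem_univ j)]

/-- **The character twist.** If `g₁` realises `s_(i,j,1)`, `g` realises `s_(i,j,ζ)` (`ζ⁶ = 1`) and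
`u` is an eigenclass of exponent `e`, then `g^* u = ζ^{eᵢ} (ζ⁻¹)^{eⱼ} · g₁^* u`: indeed `g = g_a ∘ g₁`
for the realised diagonal symmetry `a = reflCoeff i j ζ ∈ A` (`hasSymmetry`, `refl_unique`), and
`(g_a ∘ g₁)^* = g₁^* ∘ g_a^*` with `g_a^* u = χ_e(a) u`. [cite: Katz2009, §2 pp. 5–7]
[cite: BiniGarbagnati2012, §3.4] -/
theorem map_eq_smul_map_of_isEig (hij : i ≠ j) {ζ : ℂ} (hζ : ζ ^ 6 = 1)
    {g₁ g : C(Motives.ComplexPoints (fibre ψ), Motives.ComplexPoints (fibre ψ))}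
    (hg₁ : IsReflMap ψ i j 1 g₁) (hg : IsReflMap ψ i j ζ g) {e : Fin 6 → ℕ}
    {u : complexBetti (fibre ψ) (2 * 2)} (hu : IsEig ψ e u) :
    singularCohomology.map ℂ ℂ g (2 * 2) u =
      (ζ ^ e i * ζ⁻¹ ^ e j) • singularCohomology.map ℂ ℂ g₁ (2 * 2) u := by
  have hζ0 : ζ ≠ 0 := by
    rintro rfl
    norm_num at hζ
  obtain ⟨ga, hga⟩ := hasSymmetry ψ (reflCoeff i j ζ) (reflCoeff_pow_six hζ) (prod_reflCoeff hζ0)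
  have hcomp : IsReflMap ψ i j ζ (ga.comp g₁) := isReflMap_comp_of_isDiagMap hij hg₁ hga
  rw [refl_unique ψ hg hcomp, singularCohomology.map_comp, ModuleCat.comp_apply,
    hu (reflCoeff i j ζ) (reflCoeff_pow_six hζ) (prod_reflCoeff hζ0) ga hga, map_smul,
    prod_reflCoeff_pow]

/-- `Σ_{k<6} (ζ₀^m)^k = 0` for a primitive sixth root of unity `ζ₀` and `6 ∤ m` (geometric sum).
[folklore] -/
private theorem sum_pow_pow_eq_zero {ζ₀ : ℂ} (hζ₀ : IsPrimitiveRoot ζ₀ 6) {m : ℕ} (hm : ¬ 6 ∣ m) :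
    ∑ k : Fin 6, (ζ₀ ^ m) ^ (k : ℕ) = 0 := by
  have hω : ζ₀ ^ m ≠ 1 := fun h => hm ((hζ₀.pow_eq_one_iff_dvd m).1 h)
  have hω6 : (ζ₀ ^ m) ^ 6 = 1 := by
    rw [← pow_mul, mul_comm, pow_mul, hζ₀.pow_eq_one, one_pow]
  rw [Fin.sum_univ_eq_sum_range (fun k => (ζ₀ ^ m) ^ k) 6, geom_sum_eq hω, hω6, sub_self, zero_div]

/-- `eᵢ ≢ eⱼ (mod 6)` iff `6 ∤ eᵢ + 5 eⱼ`. [folklore] -/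
private theorem not_dvd_of_ne_mod_six {e : Fin 6 → ℕ} (he : (e i : ZMod 6) ≠ (e j : ZMod 6)) :
    ¬ 6 ∣ e i + 5 * e j := by
  intro h
  apply he
  have hz : ((e i + 5 * e j : ℕ) : ZMod 6) = 0 := (ZMod.natCast_eq_zero_iff _ _).2 h
  push_cast at hz
  have h6 : (5 : ZMod 6) + 1 = 0 := by decide
  linear_combination hz - (e j : ZMod 6) * h6

/-- The twist of `ζ = ζ₀ᵏ` is `ωᵏ` with `ω = ζ₀^{eᵢ + 5 eⱼ}` (using `ζ₀⁻¹ = ζ₀⁵`). [folklore] -/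
private theorem twist_pow_eq {ζ₀ : ℂ} (hζ₀ : IsPrimitiveRoot ζ₀ 6) (e : Fin 6 → ℕ) (k : ℕ) :
    (ζ₀ ^ k) ^ e i * (ζ₀ ^ k)⁻¹ ^ e j = (ζ₀ ^ (e i + 5 * e j)) ^ k := by
  have h6 : ζ₀ ^ 6 = 1 := hζ₀.pow_eq_one
  have hinv : ζ₀⁻¹ = ζ₀ ^ 5 := by
    have hne : ζ₀ ≠ 0 := hζ₀.ne_zero (by norm_num)
    rw [eq_comm, ← mul_inv_eq_one₀ (inv_ne_zero hne), inv_inv, ← pow_succ, h6]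
  rw [← inv_pow, hinv, ← pow_mul, ← pow_mul, ← pow_mul, ← pow_add, ← pow_mul]
  congr 1
  ring

/-- **The vanishing sum.** For realising maps `g_k` of `s_(i,j,ζ₀ᵏ)`, `k < 6`, and an eigenclass
`u` of exponent `e` with `eᵢ ≢ eⱼ (mod 6)`: `Σ_k g_k^* u = 0`. [cite: Katz2009, §2 pp. 5–7] -/
theorem sum_map_eq_zero_of_isEig (hij : i ≠ j) {ζ₀ : ℂ} (hζ₀ : IsPrimitiveRoot ζ₀ 6)
    {g : Fin 6 → C(Motives.ComplexPoints (fibre ψ), Motives.ComplexPoints (fibre ψ))}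
    (hg : ∀ k : Fin 6, IsReflMap ψ i j (ζ₀ ^ (k : ℕ)) (g k)) {e : Fin 6 → ℕ}
    (he : (e i : ZMod 6) ≠ (e j : ZMod 6)) {u : complexBetti (fibre ψ) (2 * 2)} (hu : IsEig ψ e u) :
    ∑ k, singularCohomology.map ℂ ℂ (g k) (2 * 2) u = 0 := by
  have hg0 : IsReflMap ψ i j 1 (g 0) := by
    have h := hg 0
    rwa [Fin.val_zero, pow_zero] at h
  have hk : ∀ k : Fin 6, singularCohomology.map ℂ ℂ (g k) (2 * 2) u =
      (ζ₀ ^ (e i + 5 * e j)) ^ (k : ℕ) • singularCohomology.map ℂ ℂ (g 0) (2 * 2) u := by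
    intro k
    rw [map_eq_smul_map_of_isEig hij (by rw [← pow_mul, mul_comm, pow_mul, hζ₀.pow_eq_one, one_pow])
      hg0 (hg k) hu, twist_pow_eq hζ₀]
  rw [Finset.sum_congr rfl fun k _ => hk k, ← Finset.sum_smul,
    sum_pow_pow_eq_zero hζ₀ (not_dvd_of_ne_mod_six he), zero_smul]

/-- **Averaging identity.** For `w = u + v` with `u`, `v` eigenclasses of exponents `e`, `e'` both
separating `i` from `j` mod `6`, and realising maps `g_k` of `s_(i,j,ζ₀ᵏ)`:
`6 • w = Σ_{k<6} (w + g_k^* w)`. [cite: Katz2009, §2 pp. 5–7] [cite: BiniGarbagnati2012, §3.4] -/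
theorem six_smul_eq_sum_add_map (hij : i ≠ j) {ζ₀ : ℂ} (hζ₀ : IsPrimitiveRoot ζ₀ 6)
    {g : Fin 6 → C(Motives.ComplexPoints (fibre ψ), Motives.ComplexPoints (fibre ψ))}
    (hg : ∀ k : Fin 6, IsReflMap ψ i j (ζ₀ ^ (k : ℕ)) (g k)) {e e' : Fin 6 → ℕ}
    (he : (e i : ZMod 6) ≠ (e j : ZMod 6)) (he' : (e' i : ZMod 6) ≠ (e' j : ZMod 6))
    {u v : complexBetti (fibre ψ) (2 * 2)} (hu : IsEig ψ e u) (hv : IsEig ψ e' v) :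
    (6 : ℂ) • (u + v) = ∑ k, ((u + v) + singularCohomology.map ℂ ℂ (g k) (2 * 2) (u + v)) := by
  rw [Finset.sum_add_distrib, Finset.sum_const, Finset.card_univ, Fintype.card_fin]
  simp_rw [map_add]
  rw [Finset.sum_add_distrib, sum_map_eq_zero_of_isEig hij hζ₀ hg he hu,
    sum_map_eq_zero_of_isEig hij hζ₀ hg he' hv, add_zero, add_zero, ← Nat.cast_smul_eq_nsmul ℂ]
  norm_num

end Twist

/-! ### §3 Eigenclass sums lie in the span of reflection-invariant rational `(2,2)`-classes -/

section Span

variable {ψ : ℂ} {i j : Fin 6}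

/-- **Main theorem (crux K2 `FlatClassesSpannedByReflectionInvariants`, granted the `(2,2)`-ness of
the class).** Let `ψ⁶ ≠ 1`, `i ≠ j`, and let `w = u + v` be a RATIONAL class of Hodge type `(2,2)` with
`u`, `v` eigenclasses of `H⁴(X_ψ(ℂ); ℂ)` of exponents `e`, `e'` satisfying `eᵢ ≢ eⱼ`, `e'ᵢ ≢ e'ⱼ (mod 6)`.
Then `w` lies in the `ℂ`-span of the rational `(2,2)`-classes `c` that are invariant under some
realised reflection `s_(i,i',ζ)` (`ζ⁶ = 1`, `i ≠ i'`): indeed `w = (1/6) Σ_k (w + g_k^* w)` over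
realising maps `g_k` of `s_(i,j,ζ₀ᵏ)`, `ζ₀ = e^{2πi/6}`. The set on the right is literally the target
of the crux. [cite: Katz2009, §2 pp. 5–7] [cite: BiniGarbagnati2012, §3.4] [cite: VoisinHodgeI2002, §7.3.2] -/
theorem mem_span_reflInvariant_of_isEig_add (hψ : ψ ^ 6 ≠ 1) (hij : i ≠ j) {e e' : Fin 6 → ℕ}
    (he : (e i : ZMod 6) ≠ (e j : ZMod 6)) (he' : (e' i : ZMod 6) ≠ (e' j : ZMod 6))
    {u v w : complexBetti (fibre ψ) (2 * 2)} (hu : IsEig ψ e u) (hv : IsEig ψ e' v) (hw : w = u + v)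
    (hrat : IsRationalClass w) (hhodge : IsOfHodgeType 4 (fibre ψ) (2 * 2) 2 2 w) :
    w ∈ Submodule.span ℂ {c : complexBetti (fibre ψ) (2 * 2) | IsRationalClass c ∧
      IsOfHodgeType 4 (fibre ψ) (2 * 2) 2 2 c ∧ ∃ i i' : Fin 6, i ≠ i' ∧ ∃ ζ : ℂ, ζ ^ 6 = 1 ∧
        ∃ g : C(Motives.ComplexPoints (fibre ψ), Motives.ComplexPoints (fibre ψ)),
          (∀ x, ∃ t : ℂ, (pt ψ (g x)).rep = t • (fun k => if k = i then ζ * (pt ψ x).rep i'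
            else if k = i' then ζ⁻¹ * (pt ψ x).rep i else (pt ψ x).rep k)) ∧
          singularCohomology.map ℂ ℂ g (2 * 2) c = c} := by
  set ζ₀ : ℂ := Complex.exp (2 * Real.pi * Complex.I / 6) with hζ₀def
  have hζ₀ : IsPrimitiveRoot ζ₀ 6 := by
    have h := Complex.isPrimitiveRoot_exp 6 (by norm_num)
    simpa using h
  have hζk : ∀ k : Fin 6, (ζ₀ ^ (k : ℕ)) ^ 6 = 1 := fun k => by
    rw [← pow_mul, mul_comm, pow_mul, hζ₀.pow_eq_one, one_pow]
  choose g hg using fun k : Fin 6 => exists_continuousMap_isRefl ψ hij (hζk k)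
  have hg' : ∀ k : Fin 6, IsReflMap ψ i j (ζ₀ ^ (k : ℕ)) (g k) := hg
  have h6 : (6 : ℂ) • w = ∑ k, (w + singularCohomology.map ℂ ℂ (g k) (2 * 2) w) := by
    rw [hw]; exact six_smul_eq_sum_add_map hij hζ₀ hg' he he' hu hv
  have hw6 : w = (6 : ℂ)⁻¹ • ∑ k, (w + singularCohomology.map ℂ ℂ (g k) (2 * 2) w) := by
    rw [← h6, smul_smul, inv_mul_cancel₀ (by norm_num : (6 : ℂ) ≠ 0), one_smul]
  rw [hw6]
  refine Submodule.smul_mem _ _ (Submodule.sum_mem _ fun k _ => Submodule.subset_span ?_)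
  exact ⟨isRationalClass_add_map (g k) hrat,
    isOfHodgeType_add_map_of_isReflMap hψ hij (hζk k) (hg' k) hhodge,
    i, j, hij, ζ₀ ^ (k : ℕ), hζk k, g k, hg k, map_add_map_of_isReflMap hij (hζk k) (hg' k) w⟩

/-- **The same, with the `(2,2)`-ness supplied by Katz's Lemma 3.1(2)** (the tree's named fact
`Katz2009_dworkSexticEigenspaces`): if moreover `e`, `e'` are non-constant characters (`6 ∣ Σ eₗ`) all
of whose totally nonzero translates have degree `3` (`hodgeCount · q = 0` for `q ≠ 2` — the case of the
route's four flat types and their conjugates), then every RATIONAL `w = u + v` lies in that span.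
[cite: Katz2009, Lemma 3.1(2)] [cite: BiniGarbagnati2012, §3.4] -/
theorem mem_span_reflInvariant_of_isEig_add_of_katz (hK : Katz2009_dworkSexticEigenspaces)
    (hψ : ψ ^ 6 ≠ 1) (hij : i ≠ j)
    {e e' : Fin 6 → ℕ} (he : (e i : ZMod 6) ≠ (e j : ZMod 6)) (he' : (e' i : ZMod 6) ≠ (e' j : ZMod 6))
    (hsum : 6 ∣ ∑ l, e l) (hnc : ¬ ∃ r : ZMod 6, ∀ l, (e l : ZMod 6) = r)
    (hdeg : ∀ q, q ≠ 2 → hodgeCount e q = 0)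
    (hsum' : 6 ∣ ∑ l, e' l) (hnc' : ¬ ∃ r : ZMod 6, ∀ l, (e' l : ZMod 6) = r)
    (hdeg' : ∀ q, q ≠ 2 → hodgeCount e' q = 0)
    {u v w : complexBetti (fibre ψ) (2 * 2)} (hu : IsEig ψ e u) (hv : IsEig ψ e' v) (hw : w = u + v)
    (hrat : IsRationalClass w) :
    w ∈ Submodule.span ℂ {c : complexBetti (fibre ψ) (2 * 2) | IsRationalClass c ∧
      IsOfHodgeType 4 (fibre ψ) (2 * 2) 2 2 c ∧ ∃ i i' : Fin 6, i ≠ i' ∧ ∃ ζ : ℂ, ζ ^ 6 = 1 ∧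
        ∃ g : C(Motives.ComplexPoints (fibre ψ), Motives.ComplexPoints (fibre ψ)),
          (∀ x, ∃ t : ℂ, (pt ψ (g x)).rep = t • (fun k => if k = i then ζ * (pt ψ x).rep i'
            else if k = i' then ζ⁻¹ * (pt ψ x).rep i else (pt ψ x).rep k)) ∧
          singularCohomology.map ℂ ℂ g (2 * 2) c = c} := by
  obtain ⟨A⟩ := nonempty_hodgeModel_holds (n := 4) (X := fibre ψ) (isSmoothProjective_fibre hψ)
  have hu2 : IsOfHodgeType 4 (fibre ψ) (2 * 2) 2 2 u :=
    hK.isOfHodgeType_two_two hψ (hasSymmetry ψ) hsum hnc hdeg A hu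
  have hv2 : IsOfHodgeType 4 (fibre ψ) (2 * 2) 2 2 v :=
    hK.isOfHodgeType_two_two hψ (hasSymmetry ψ) hsum' hnc' hdeg' A hv
  exact mem_span_reflInvariant_of_isEig_add hψ hij he he' hu hv hw hrat
    (hw ▸ hu2.add (isSmoothProjective_fibre hψ) hv2)

end Span

/-! ### §4 The route's four flat exponent types (Katz's list), in every position -/

section FlatTypes

/-- `hodgeCount` is invariant under permuting the coordinates (the translates are permuted, total
non-vanishing and the degree — a symmetric function — are unchanged). [cite: Katz2009, Lemma 3.1] -/
theorem hodgeCount_comp_equiv (e : Fin 6 → ℕ) (σ : Equiv.Perm (Fin 6)) (q : ℕ) :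
    hodgeCount (fun l => e (σ l)) q = hodgeCount e q := by
  unfold hodgeCount
  congr 1
  refine Finset.filter_congr fun r _ => ?_
  have htr : translate (fun l => e (σ l)) r = fun l => translate e r (σ l) := rfl
  have hnz : IsTotallyNonzero (translate (fun l => e (σ l)) r) ↔ IsTotallyNonzero (translate e r) := by
    rw [htr]
    exact ⟨fun h l => by simpa using h (σ.symm l), fun h l => h (σ l)⟩
  have hdeg : degree (translate (fun l => e (σ l)) r) = degree (translate e r) := by
    rw [htr, degree, degree, Equiv.sum_comp σ (fun l => (translate e r l).val)]
  rw [hnz, hdeg]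

/-- Katz's four flat exponent types of the route `DworkReflectionQuotients` (crux K2):
`(1,2,3,3,4,5)`, `(1,2,2,3,5,5)`, `(1,1,2,4,5,5)`, `(1,1,3,3,5,5)`. [cite: Katz2009, Lemma 3.1] -/
def flatTypes : Fin 4 → Fin 6 → ℕ :=
  ![![1, 2, 3, 3, 4, 5], ![1, 2, 2, 3, 5, 5], ![1, 1, 2, 4, 5, 5], ![1, 1, 3, 3, 5, 5]]

/-- The four types and their conjugates `6 − e` have character sum `18`, and all their totally
nonzero translates have degree `3` (pure type `(2,2)` pieces). [cite: Katz2009, Lemma 3.1] -/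
theorem flatTypes_counts (j : Fin 4) :
    (∑ l, flatTypes j l = 18) ∧ (∑ l, (6 - flatTypes j l) = 18) ∧
      (∀ q, q ≠ 2 → hodgeCount (flatTypes j) q = 0) ∧
      (∀ q, q ≠ 2 → hodgeCount (fun l => 6 - flatTypes j l) q = 0) := by
  refine ⟨by fin_cases j <;> decide, by fin_cases j <;> decide, fun q hq => ?_, fun q hq => ?_⟩
  · rcases Nat.lt_or_ge 4 q with h | h
    · exact hodgeCount_eq_zero_of_lt h
    · interval_cases q <;> first | exact absurd rfl hq | (fin_cases j <;> decide)
  · rcases Nat.lt_or_ge 4 q with h | h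
    · exact hodgeCount_eq_zero_of_lt h
    · interval_cases q <;> first | exact absurd rfl hq | (fin_cases j <;> decide)

/-- Coordinates `0` and `5` separate every type mod `6` (values `1` and `5`), and likewise for the
conjugate type (values `5` and `1`). [cite: Katz2009, Lemma 3.1] -/
theorem flatTypes_zero_ne_five (j : Fin 4) :
    (flatTypes j 0 : ZMod 6) ≠ (flatTypes j 5 : ZMod 6) ∧
      ((6 - flatTypes j 0 : ℕ) : ZMod 6) ≠ ((6 - flatTypes j 5 : ℕ) : ZMod 6) := by
  fin_cases j <;> decide

/-- **Crux K2 of route `DworkReflectionQuotients`, granted Katz 2009 Lemma 3.1(2)** (the named fact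
`Katz2009_dworkSexticEigenspaces`): for `ψ⁶ ≠ 1`, every type `e` among Katz's four flat types in any
position `σ ∈ 𝔖₆`, and every RATIONAL class `w = u + v` with `u` an eigenclass of exponent `e ∘ σ` and
`v` one of exponent `(6 − e) ∘ σ`, the class `w` lies in the `ℂ`-span of the rational `(2,2)`-classes
invariant under some realised reflection `s_(i,i',ζ)` — by the averaging identity over the six
reflections `s_(σ⁻¹0, σ⁻¹5, ζ₀ᵏ)`. This is the body of the crux `FlatClassesSpannedByReflectionInvariants`
with `X_ψ = DworkSextic.fibre ψ`, `pt = DworkSextic.pt ψ`, `IsEig = DworkSextic.IsEig ψ`.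
[cite: Katz2009, Lemma 3.1 and §2 pp. 5–7] [cite: BiniGarbagnati2012, §3.4] [cite: VoisinHodgeI2002, §7.3.2] -/
theorem flatClasses_mem_span_reflInvariant_of_katz (hK : Katz2009_dworkSexticEigenspaces) {ψ : ℂ}
    (hψ : ψ ^ 6 ≠ 1) (j : Fin 4) (σ : Equiv.Perm (Fin 6)) (w : complexBetti (fibre ψ) (2 * 2))
    (hrat : IsRationalClass w)
    (huv : ∃ u v : complexBetti (fibre ψ) (2 * 2), IsEig ψ (fun l => flatTypes j (σ l)) u ∧
      IsEig ψ (fun l => 6 - flatTypes j (σ l)) v ∧ w = u + v) :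
    w ∈ Submodule.span ℂ {c : complexBetti (fibre ψ) (2 * 2) | IsRationalClass c ∧
      IsOfHodgeType 4 (fibre ψ) (2 * 2) 2 2 c ∧ ∃ i i' : Fin 6, i ≠ i' ∧ ∃ ζ : ℂ, ζ ^ 6 = 1 ∧
        ∃ g : C(Motives.ComplexPoints (fibre ψ), Motives.ComplexPoints (fibre ψ)),
          (∀ x, ∃ t : ℂ, (pt ψ (g x)).rep = t • (fun k => if k = i then ζ * (pt ψ x).rep i'
            else if k = i' then ζ⁻¹ * (pt ψ x).rep i else (pt ψ x).rep k)) ∧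
          singularCohomology.map ℂ ℂ g (2 * 2) c = c} := by
  obtain ⟨u, v, hu, hv, hw⟩ := huv
  obtain ⟨hsum, hsum', hdeg, hdeg'⟩ := flatTypes_counts j
  obtain ⟨hne, hne'⟩ := flatTypes_zero_ne_five j
  have hij : σ.symm 0 ≠ σ.symm 5 := fun h => by simpa using congrArg σ h
  refine mem_span_reflInvariant_of_isEig_add_of_katz hK hψ hij (e := fun l => flatTypes j (σ l))
    (e' := fun l => 6 - flatTypes j (σ l)) ?_ ?_ ?_ ?_ ?_ ?_ ?_ ?_ hu hv hw hrat
  · simpa using hne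
  · simpa using hne'
  · rw [Equiv.sum_comp σ (fun l => flatTypes j l), hsum]; norm_num
  · rintro ⟨r, hr⟩
    have h0 := hr (σ.symm 0)
    have h5 := hr (σ.symm 5)
    simp only [Equiv.apply_symm_apply] at h0 h5
    exact hne (h0.trans h5.symm)
  · intro q hq
    rw [hodgeCount_comp_equiv (flatTypes j) σ q, hdeg q hq]
  · rw [Equiv.sum_comp σ (fun l => 6 - flatTypes j l), hsum']; norm_num
  · rintro ⟨r, hr⟩
    have h0 := hr (σ.symm 0)
    have h5 := hr (σ.symm 5)
    simp only [Equiv.apply_symm_apply] at h0 h5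
    exact hne' (h0.trans h5.symm)
  · intro q hq
    rw [hodgeCount_comp_equiv (fun l => 6 - flatTypes j l) σ q, hdeg' q hq]

end FlatTypes

end Literature.AlgebraicGeometry.HodgeTheory.DworkSextic

end
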